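import Summits.BirchSwinnertonDyer.BirchSwinnertonDyer.Theorems.SchneiderFreeAdditiveX3NATKYBranchThreeOfTree
import Summits.BirchSwinnertonDyer.BirchSwinnertonDyer.Theorems.SchneiderFreeAdditiveX3NATLambdaAlgebraicSide
import Summits.BirchSwinnertonDyer.BirchSwinnertonDyer.Theorems.SchneiderFreeAdditiveX3KYBranchThreeDoorBROfTree
import HarnessLib

/-!
# Route `SchneiderFreeAdditiveX3` (K1 door): the `p = 3` NON-ANOMALOUS column ON THE NAT INDEX ROAD, part 2 (FILE E2) — [INV.λ≤], Keller–Yin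
# Thm. 3.5.1 in branch currency and H3♭ᶜ at a ♭-frame WITHOUT CGLS 2022 Prop. 1.2.5 / Prop. 14 / Cor. 1.2.6 and without the Milne binder
# (twins of generation 42's F48b `…KYBranchThreeDoorBROfTree`)

Cell `bsd-schneider-ideate`, seat `bsd-schneider-door-c5` (prover, generation 43; assembly layer; `--supports` 19177).  PARTITION: board row
B6 ∩ X3 ∩ sst-twist, `r = 1`, (G-ord, `e = 2`) half at `p = 3`, NON-ANOMALOUS twist (686 of 2 411 pairs; class-wide) of `Rank1Residual.partition` —
ASSEMBLY; types-the-object-of nothing new; RE-KEYS F48b's `exists_firstUnitCoeffAt_le_lambdaInvariant_three` / `xac_charIdeal_map_eq_span_three_of_dvd` /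
`xac_charIdeal_map_le_span_three_of_dvd` / `xac_charIdeal_map_le_span_three_self_of_dvd` off the CGLS count: the door inequality is now FILE D's
`NATLambdaAlgebraicSide.add_add_sum_le_lambdaInvariant_xAc_empty_add_sum_curveLocalLambda_of_decomp_ne_one` (V21 index road, «no local fixed vectors»
orientation, NO named hypothesis), so the five binders `hprop125`/`hge`/`hfact`/`hlift`/`hlocal` and the Milne binder `hPT` DISAPPEAR; the Rubin–Hida data at
the datum are now the UNRAMIFIED clauses `hRH` (f.g., torsion, `μ = 0`, `λ = n_φ` for every primitive unramified dual datum of either member) together with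
the two orientation facts «some `τ ∈ D_v̄` has `θ(τ) ≠ 1`» — FILE E1 (`NATKYBranchThree.exists_aux3nat_of_thm212`) PRODUCES them from cell `bsd-eis`'s
[BR𝟙]/[BRω] roads and generation 25's non-anomalous character binders; FILE E3 consumes them.  `X_ac^∅(W_K)` torsion with `μ = 0` is RETURNED by FILE D (no CGLS
Prop. 14).  Proofs otherwise token-identical to F48b; closes none of B6's cells (BSD NOT advanced).  bears_on: K1-door (19177 r3 `GordTwoBranchIMC`).

INPUT LEDGER of the `p = 3` NAT sub-column's algebraic side after this file: {the unramified clauses at the datum (FILE E1: Bleher et al. 3.3.1, de Shalit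
II.6.4, Hida Thm. I)} — CGLS Prop. 1.2.5, Prop. 14, Cor. 1.2.6 and [BR3] GONE.
HONEST FRAMING: compositions of tree theorems, CONDITIONAL BY NAME on the displayed statements ([DIV.dvd], [AN3] carry Keller–Yin claim tags); no definition,
no named fact, no `sorry`; nothing analytic is formalised; nothing is closed; BSD proved for no curve; «closes rung: none».  References: [KellerYin2024b] Thm.
3.3.6, Prop. 3.4.4, §3.5, Thm. 3.5.1; [KellerYin2024] Thm. 1.4.1 (iii); [CastellaGrossiLeeSkinner2022] Thms. 1.2.2, 2.1.2, 2.2.2; [CastellaHsieh2018] §3.3, Def.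
3.7, Prop. 3.8; this seat p680016 (gen 26), p755154 / p755440 (F39a/b, gen 40), F48b (gen 42, the template), F49a–e1 (gen 43).
-/

set_option autoImplicit false
set_option linter.dupNamespace false -- the summit namespace `…BirchSwinnertonDyer.BirchSwinnertonDyer.Theorems` (Sub = Summit, D-0017) trips it

noncomputable section

open scoped Classical NumberField Pointwise

open Field NumberField IsDedekindDomain WeierstrassCurve PowerSeries Rat.HeightOneSpectrum
  Literature.NumberTheory.EllipticCurves Literature.NumberTheory.EllipticCurves.GreenbergSelmer
  Literature.NumberTheory.GaloisRepresentations Literature.NumberTheory.GaloisCohomology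
  Literature.NumberTheory.EllipticCurves.ModularForms Literature.NumberTheory.EllipticCurves.Rank1Residual
  Literature.NumberTheory.EllipticCurves.Rank1Residual.Typed
  Literature.NumberTheory.EllipticCurves.KellerYin2024 Literature.NumberTheory.EllipticCurves.CaiShuTian2014
  Literature.NumberTheory.QuadraticFields
  Literature.NumberTheory.IwasawaTheory Literature.NumberTheory.IwasawaTheory.Greenberg2016 Literature.NumberTheory.IwasawaTheory.Greenberg2006
  Summit.BirchSwinnertonDyer.Rank1Residual Summit.BirchSwinnertonDyer.Rank1Residual.X11b
  Summit.BirchSwinnertonDyer.Rank1Residual.X11b.Halves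
  Summit.BirchSwinnertonDyer.Rank1Residual.X11b.CongruenceLimit Summit.BirchSwinnertonDyer.Rank1Residual.Additive
  Summit.BirchSwinnertonDyer.BirchSwinnertonDyer.Theorems.SchneiderFree
  Summit.BirchSwinnertonDyer.BirchSwinnertonDyer.Theorems.SchneiderFree.Upper
  Summit.BirchSwinnertonDyer.BirchSwinnertonDyer.Theorems.SchneiderFree.KYRead
  Summit.BirchSwinnertonDyer.BirchSwinnertonDyer.Theorems.SchneiderFree.GoodMember
  Summit.BirchSwinnertonDyer.BirchSwinnertonDyer.Theses.SchneiderFreeAdditiveX3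
  Summit.BirchSwinnertonDyer.BirchSwinnertonDyer.Theorems.SchneiderFreeAdditiveX3.LZZMatch
  Summit.BirchSwinnertonDyer.BirchSwinnertonDyer.Theorems.SchneiderFreeAdditiveX3.ControlDischarged
  Summit.BirchSwinnertonDyer.BirchSwinnertonDyer.Theorems.SchneiderFreeAdditiveX3.KYBranchOnly
  Summit.BirchSwinnertonDyer.BirchSwinnertonDyer.Theorems.SchneiderFreeAdditiveX3.KYNonAnomalousTwist
  Summit.BirchSwinnertonDyer.BirchSwinnertonDyer.Theorems.SchneiderFreeAdditiveX3.UpperOfPrintNonAnomalousTwist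
  Summit.BirchSwinnertonDyer.BirchSwinnertonDyer.Theorems.EisensteinPrimesMuLambda
  Summit.BirchSwinnertonDyer.BirchSwinnertonDyer.Theorems.TeichmullerPairUnramifiedAtMult
  Summit.BirchSwinnertonDyer.BirchSwinnertonDyer.Theorems.KatzLineFrame
open Literature.NumberTheory.EllipticCurves.CastellaGrossiLeeSkinner2022
  (cor126_residualCharacter_globalLift cor126_residualCharacter_localSurjective
    prop125_characterGrSelmerDual_torsion_muZero_dim prop125_characterGrSelmerDual_corank_ge prop14_residualCharacterSelmer_finite
    thm212_exists_isKatzLFunction IsKatzLFunction)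

namespace Summit.BirchSwinnertonDyer.BirchSwinnertonDyer.Theorems.SchneiderFreeAdditiveX3.NATKYBranchThreeDoor

/-! ### §1 [INV.λ≤] and Keller–Yin Thm. 3.5.1 in branch currency at `p = 3`, NAT twist, with the λ-clauses displayed (twins of F39a §2) -/

section Three

open IsDedekindDomain.HeightOneSpectrum Literature.NumberTheory.EllipticCurves.IwasawaAlgebra
  Literature.NumberTheory.EllipticCurves.GreenbergVatsal2000
  Literature.NumberTheory.EllipticCurves.IwasawaDual Literature.NumberTheory.EllipticCurves.Castella2018.AcSelmer
  Summit.BirchSwinnertonDyer.Rank1Residual.X2.ResidualDevissageModules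
  Summit.BirchSwinnertonDyer.BirchSwinnertonDyer.Theorems
  Summit.BirchSwinnertonDyer.BirchSwinnertonDyer.Theorems.SchneiderFreeAdditiveX3
  Summit.BirchSwinnertonDyer.BirchSwinnertonDyer.Theorems.SchneiderFreeAdditiveX3.KYLambdaAlg
  Summit.BirchSwinnertonDyer.BirchSwinnertonDyer.Theorems.SchneiderFreeAdditiveX3.KYLambdaAlgChar
  Summit.BirchSwinnertonDyer.BirchSwinnertonDyer.Theorems.SchneiderFreeAdditiveX3.KYBranchHalves
  Summit.BirchSwinnertonDyer.BirchSwinnertonDyer.Theorems.SchneiderFreeAdditiveX3.KYLambdaAlgOfCGLS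

/-- **[INV.λ≤] ∧ KYμ ∧ [INV.μ] at `p = 3`, non-anomalous twist, at a SIGNED Castella–Hsieh frame, CGLS-§1.2-FREE** (the Rubin–Hida data at the datum are
the UNRAMIFIED clauses `hRH` — f.g., torsion, `μ = 0`, `λ = n_φ` for every primitive unramified dual datum of `θsub` and of `θquot` — and the two orientation
facts, produced from the tree by FILE E1 `exists_aux3nat_of_thm212`) — F48b's `exists_firstUnitCoeffAt_le_lambdaInvariant_three` with the door inequality taken
from the NAT INDEX ROAD (FILE D `NATLambdaAlgebraicSide.add_add_sum_le_lambdaInvariant_xAc_empty_add_sum_curveLocalLambda_of_decomp_ne_one`, no named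
hypothesis; `ι : K → ℚ₃` the embedding at the degree-one prime `v`): from [AN3] `n + Σ λ𝒫_w(W_K) = 2nφ + ΣΣ`, the λ-clauses and that inequality,
`∃ n, FirstUnitCoeffAt L n ∧ n ≤ λ(X_ac^∅(W_K))`; ALSO returned: `X_ac^∅(W_K)` is `Λ`-torsion with `μ = 0` (FILE D, no CGLS Prop. 14).
[claim: KellerYin2024PotOrd, status: under-review] [cite: KellerYin2024b, §3.5 and Thm. 3.5.1 (arXiv:2410.23241 p. 20) (the λ-comparison, preprint; hypotheses)]
[cite: KellerYin2024, Thm. 1.4.1 (iii) (arXiv:2402.12781v2)] [cite: CastellaGrossiLeeSkinner2022, Thms. 1.2.2, 2.2.2, 2.2.4] -/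
theorem exists_firstUnitCoeffAt_le_lambdaInvariant_three
    (hAN : thm351_anacong_branch_three)
    (ι' : PadicAlgCl 3 ≃+* ℂ) (W : WeierstrassCurve ℚ) [W.IsElliptic] [W.IsGloballyMinimal]
    (K : Type) [Field K] [NumberField K] [IsGalois ℚ K]
    (v vbar : HeightOneSpectrum (𝓞 K)) (κ : ZpExtension K 3) (γ : absoluteGaloisGroup K)
    [hγ : Fact (κ.IsTopGenerator γ)] {N : ℕ} [NeZero N] {f : CuspForm (CongruenceSubgroup.Gamma0 N) 2}
    (hf : IsNewformOf W f) (hS : PotOrdSetting ι' W K v vbar κ N)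
    (hX : ClassX3 W 3)
    (hna : ∀ (V : WeierstrassCurve ℚ) [V.IsElliptic] [V.IsGloballyMinimal] (C : VariableChange ℚ),
      GoodOrd V 3 → C • V.quadraticTwist ((-1 : ℚ) ^ (3 / 2) * (3 : ℕ)) = W → ¬ (3 : ℤ) ∣ V.frobeniusTrace 3 - 1)
    (hv3 : ((3 : ℕ) : 𝓞 K) ∈ v.asIdeal)
    {N' : ℕ} [NeZero N'] {f' : CuspForm (CongruenceSubgroup.Gamma0 N') 2} (hf' : IsNewform0 f') (hN' : ¬ 3 ∣ N')
    (htw : ∃ S : Finset ℕ, ∀ ℓ : ℕ, ℓ.Prime → ℓ ∉ S →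
      cuspCoeff f ℓ = ((legendreSym 3 ℓ : ℤ) : ℂ) * cuspCoeff f' ℓ)
    {θsub θquot : FramedGaloisRep K (padicCoeffIntegers (∅ : Set (PadicAlgCl 3))) 1}
    (hpair : IsResidualPairOver (W.baseChange K) 3 θsub θquot)
    {θ₀ : FramedGaloisRep K (padicCoeffIntegers (∅ : Set (PadicAlgCl 3))) 1} (hθ₀ : θ₀ = θsub ∨ θ₀ = θquot)
    {θ₀K : HeckeCharacter K} (hθ₀K : IsHeckeCharOf ι' θ₀ θ₀K) (hv0 : θ₀K.IsUnramifiedAt v) (hvbar0 : θ₀K.IsUnramifiedAt vbar)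
    {Cbar : Finset (HeightOneSpectrum (𝓞 K))} (hCbar : ∀ u ∈ Cbar, ¬ θ₀K.IsUnramifiedAt u)
    {ΩK' : ℂ} {Ωp' : (unrIntegers 3)ˣ} {Lφ : UnrSeries 3} (hΩK' : ΩK' ≠ 0)
    (hLφ : IsKatzLFunction ι' v vbar Cbar κ γ θ₀K ΩK' ((Ωp' : unrIntegers 3) : ℂ_[3]) Lφ)
    {nφ : ℕ} (hnφ : FirstUnitCoeffAt Lφ nφ)
    (hRH : ∀ θ : FramedGaloisRep K (padicCoeffIntegers (∅ : Set (PadicAlgCl 3))) 1, (θ = θsub ∨ θ = θquot) →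
      (∀ D : DatumDualData κ γ (charModule (∅ : Set (PadicAlgCl 3)) θ)
          (Castella2018.AcSelmer.bdpData (charModule (∅ : Set (PadicAlgCl 3)) θ) 3 vbar) (∅ : Set (HeightOneSpectrum (𝓞 K))),
        Module.Finite (IwasawaAlgebra 3) D.X ∧ Module.IsTorsion (IwasawaAlgebra 3) D.X ∧ muInvariant 3 D.X = 0 ∧ lambdaInvariant 3 D.X = nφ) ∧
      ∃ τ ∈ decomp vbar, unitChar θ τ ≠ 1)
    {e : ℂ} {ΩK : ℂ} {Ωp : (unrIntegers 3)ˣ} {L : UnrSeries 3} (he : e = 1 ∨ e = -1) (hΩK : ΩK ≠ 0)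
    (hL : IsBranchBDPLFunction ι' v κ γ f' (KellerYin2024.genusHeckeCharacter K 3) e ΩK ((Ωp : unrIntegers 3) : ℂ_[3]) L) :
    (∃ n : ℕ, FirstUnitCoeffAt L n ∧
      n ≤ lambdaInvariant 3 (XAc (W.baseChange K) 3 κ vbar (∅ : Set (HeightOneSpectrum (𝓞 K))) γ)) ∧
    (Module.IsTorsion (IwasawaAlgebra 3) (XAc (W.baseChange K) 3 κ vbar (∅ : Set (HeightOneSpectrum (𝓞 K))) γ) ∧
      muInvariant 3 (XAc (W.baseChange K) 3 κ vbar (∅ : Set (HeightOneSpectrum (𝓞 K))) γ) = 0) := by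
  obtain ⟨Sf, hSf⟩ := KYBranchThree.exists_finset_primes_over_not_three (K := K) N
  have hSf' : ∀ w : HeightOneSpectrum (𝓞 K), w ∈ Sf ↔
      (((W.conductorNorm ℤ : ℤ) : 𝓞 K) ∈ w.asIdeal ∧ ((3 : ℕ) : 𝓞 K) ∉ w.asIdeal) := by
    rw [hS.level]; exact hSf
  -- [AN3]
  obtain ⟨n, nφ', hLn, hLφn', hcount⟩ := hAN ι' W K v vbar κ γ hf hS hna hf' hN' htw θsub θquot hpair Sf hSf θ₀ hθ₀ θ₀K
    hθ₀K hv0 hvbar0 Cbar hCbar ΩK' Ωp' Lφ hΩK' hLφ e ΩK Ωp L he hΩK hL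
  -- the count's index IS the given first-unit index (uniqueness); the unramified clauses and orientation facts are HYPOTHESES here (FILE E1 produces them)
  have hnn : nφ' = nφ := hLφn'.unique hnφ
  rw [hnn] at hcount
  obtain ⟨Dsub⟩ := nonempty_unrDualData_char (∅ : Set (PadicAlgCl 3)) θsub κ vbar (∅ : Set (HeightOneSpectrum (𝓞 K))) hγ.out
  obtain ⟨Dquot⟩ := nonempty_unrDualData_char (∅ : Set (PadicAlgCl 3)) θquot κ vbar (∅ : Set (HeightOneSpectrum (𝓞 K))) hγ.out
  obtain ⟨hRHs, hsubD⟩ := hRH θsub (Or.inl rfl)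
  obtain ⟨hRHq, hquotD⟩ := hRH θquot (Or.inr rfl)
  have hsub : lambdaInvariant 3 Dsub.X = nφ := (hRHs Dsub).2.2.2
  have hquot : lambdaInvariant 3 Dquot.X = nφ := (hRHq Dquot).2.2.2
  -- the embedding `K ↪ ℚ₃` at the degree-one prime `v`
  obtain ⟨he1, hf1⟩ := degreeOne_of_splitsIn hS.imagQuad.1 hS.split hv3
  -- the CGLS-§1.2-free door inequality (FILE D: the NAT index road)
  obtain ⟨h0, hineq⟩ := NATLambdaAlgebraicSide.add_add_sum_le_lambdaInvariant_xAc_empty_add_sum_curveLocalLambda_of_decomp_ne_one W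
    (by norm_num) hX.2 K hS.imagQuad (by rw [hS.level]; exact hS.heegner) (embAt K 3 v hv3 he1 hf1) v vbar
    (fun x ↦ mem_asIdeal_iff_norm_embAt_lt_one v hv3 he1 hf1 x) hS.mem_vbar hS.vbar_ne κ hS.anticyclotomic γ θsub θquot hpair hsubD hquotD
    Sf hSf' Dsub Dquot (fun D ↦ ⟨(hRHs D).1, (hRHs D).2.1, (hRHs D).2.2.1⟩) (fun D ↦ ⟨(hRHq D).1, (hRHq D).2.1, (hRHq D).2.2.1⟩)
  rw [hsub, hquot] at hineq
  refine ⟨⟨n, hLn, ?_⟩, h0⟩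
  omega

/-- **Keller–Yin Thm. 3.5.1 (branch currency) at `p = 3` for a non-anomalous twist, at a signed frame, along any structure map `j`, CGLS-§1.2-free (the unramified clauses displayed):**
`Ch_Λ(X_ac^∅(W_K))·R₀⟦T⟧ = (L)` and the first unit coefficient of `L` sits EXACTLY at `λ(𝔛)` — from [DIV.dvd] (PREPRINT), [AN3], the unramified clauses at the
datum and the NAT index road; F48b's theorem with the theorem above in place of its CGLS-fed λ-inequality and Prop. 14. [claim: KellerYin2024PotOrd, status: under-review]
[cite: KellerYin2024b, Thm. 3.3.6, Prop. 3.4.4, §3.5 and Thm. 3.5.1 (arXiv:2410.23241 pp. 19–20) (preprint; hypotheses and the sentence derived)]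
[cite: CastellaGrossiLeeSkinner2022, Thm. 3.2.1, Thms. 1.2.2, 2.2.2] [cite: KellerYin2024, Thm. 1.4.1 (iii)] [cite: Washington1997, §7.1 Prop. 7.2 and §13.2] -/
theorem xac_charIdeal_map_eq_span_three_of_dvd
    (hAN : thm351_anacong_branch_three)
    (hDVD : thm336_dvd_branch_OPEN)
    (ι' : PadicAlgCl 3 ≃+* ℂ) (W : WeierstrassCurve ℚ) [W.IsElliptic] [W.IsGloballyMinimal]
    (K : Type) [Field K] [NumberField K] [IsGalois ℚ K]
    (v vbar : HeightOneSpectrum (𝓞 K)) (κ : ZpExtension K 3) (γ : absoluteGaloisGroup K)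
    [hγ : Fact (κ.IsTopGenerator γ)] {N : ℕ} [NeZero N] {f : CuspForm (CongruenceSubgroup.Gamma0 N) 2}
    (hf : IsNewformOf W f) (hS : PotOrdSetting ι' W K v vbar κ N)
    (hX : ClassX3 W 3)
    (hna : ∀ (V : WeierstrassCurve ℚ) [V.IsElliptic] [V.IsGloballyMinimal] (C : VariableChange ℚ),
      GoodOrd V 3 → C • V.quadraticTwist ((-1 : ℚ) ^ (3 / 2) * (3 : ℕ)) = W → ¬ (3 : ℤ) ∣ V.frobeniusTrace 3 - 1)
    (hv3 : ((3 : ℕ) : 𝓞 K) ∈ v.asIdeal)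
    {N' : ℕ} [NeZero N'] {f' : CuspForm (CongruenceSubgroup.Gamma0 N') 2} (hf' : IsNewform0 f') (hN' : ¬ 3 ∣ N')
    (htw : ∃ S : Finset ℕ, ∀ ℓ : ℕ, ℓ.Prime → ℓ ∉ S →
      cuspCoeff f ℓ = ((legendreSym 3 ℓ : ℤ) : ℂ) * cuspCoeff f' ℓ)
    {θsub θquot : FramedGaloisRep K (padicCoeffIntegers (∅ : Set (PadicAlgCl 3))) 1}
    (hpair : IsResidualPairOver (W.baseChange K) 3 θsub θquot)
    {θ₀ : FramedGaloisRep K (padicCoeffIntegers (∅ : Set (PadicAlgCl 3))) 1} (hθ₀ : θ₀ = θsub ∨ θ₀ = θquot)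
    {θ₀K : HeckeCharacter K} (hθ₀K : IsHeckeCharOf ι' θ₀ θ₀K) (hv0 : θ₀K.IsUnramifiedAt v) (hvbar0 : θ₀K.IsUnramifiedAt vbar)
    {Cbar : Finset (HeightOneSpectrum (𝓞 K))} (hCbar : ∀ u ∈ Cbar, ¬ θ₀K.IsUnramifiedAt u)
    {ΩK' : ℂ} {Ωp' : (unrIntegers 3)ˣ} {Lφ : UnrSeries 3} (hΩK' : ΩK' ≠ 0)
    (hLφ : IsKatzLFunction ι' v vbar Cbar κ γ θ₀K ΩK' ((Ωp' : unrIntegers 3) : ℂ_[3]) Lφ)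
    {nφ : ℕ} (hnφ : FirstUnitCoeffAt Lφ nφ)
    (hRH : ∀ θ : FramedGaloisRep K (padicCoeffIntegers (∅ : Set (PadicAlgCl 3))) 1, (θ = θsub ∨ θ = θquot) →
      (∀ D : DatumDualData κ γ (charModule (∅ : Set (PadicAlgCl 3)) θ)
          (Castella2018.AcSelmer.bdpData (charModule (∅ : Set (PadicAlgCl 3)) θ) 3 vbar) (∅ : Set (HeightOneSpectrum (𝓞 K))),
        Module.Finite (IwasawaAlgebra 3) D.X ∧ Module.IsTorsion (IwasawaAlgebra 3) D.X ∧ muInvariant 3 D.X = 0 ∧ lambdaInvariant 3 D.X = nφ) ∧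
      ∃ τ ∈ decomp vbar, unitChar θ τ ≠ 1)
    {e : ℂ} {ΩK : ℂ} {Ωp : (unrIntegers 3)ˣ} {L : UnrSeries 3} (he : e = 1 ∨ e = -1) (hΩK : ΩK ≠ 0)
    (hL : IsBranchBDPLFunction ι' v κ γ f' (KellerYin2024.genusHeckeCharacter K 3) e ΩK ((Ωp : unrIntegers 3) : ℂ_[3]) L)
    (j : ℤ_[3] →+* unrIntegers 3)
    (hj : ∀ x : ℤ_[3], ((j x : unrIntegers 3) : ℂ_[3]) = algebraMap ℚ_[3] ℂ_[3] (x : ℚ_[3])) :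
    (XAc.charIdeal (W.baseChange K) 3 κ vbar (∅ : Set (HeightOneSpectrum (𝓞 K))) γ).map (PowerSeries.map j) =
        Ideal.span {L} ∧
      ∃ n : ℕ, FirstUnitCoeffAt L n ∧
        n = lambdaInvariant 3 (XAc (W.baseChange K) 3 κ vbar (∅ : Set (HeightOneSpectrum (𝓞 K))) γ) := by
  -- `𝔛` torsion with `μ = 0` is RETURNED by the NAT index road (FILE D), no CGLS Prop. 14
  obtain ⟨⟨n, hLn, hle⟩, hT, hμ⟩ := exists_firstUnitCoeffAt_le_lambdaInvariant_three hAN ι' W K v vbar κ γ hf hS hX hna hv3 hf' hN' htw hpair hθ₀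
    hθ₀K hv0 hvbar0 hCbar hΩK' hLφ hnφ hRH he hΩK hL
  have he0 : e ≠ 0 := by rcases he with rfl | rfl <;> norm_num
  have hΩp0 : ((Ωp : unrIntegers 3) : ℂ_[3]) ≠ 0 := by
    rw [Ne, ZeroMemClass.coe_eq_zero]; exact Ωp.ne_zero
  obtain ⟨k, hk⟩ := hDVD ι' W K v vbar κ γ hf hS hf' hN' htw e ΩK _ L he0 hΩK hΩp0 hL j hj
  haveI : Module.Finite (IwasawaAlgebra 3) (XAc (W.baseChange K) 3 κ vbar (∅ : Set (HeightOneSpectrum (𝓞 K))) γ) :=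
    XAc.module_finite_empty _ 3 κ vbar γ
  obtain ⟨heq, hn⟩ := charIdeal_map_eq_span_of_C_pow_mul_mem_of_firstUnitCoeff_le _ hT hμ j hj hLn hle hk
  exact ⟨heq, n, hLn, hn⟩

/-- **The door direction H3 at the frame** (`Ch_Λ(X_ac^∅(W_K))·R₀⟦T⟧ ⊆ (L)`) at `p = 3` for a non-anomalous twist, CGLS-§1.2-free (the unramified clauses displayed).
[claim: KellerYin2024PotOrd, status: under-review] [cite: KellerYin2024b, Thm. 3.5.1 (arXiv:2410.23241 p. 20) (preprint; the door direction of its conclusion)] -/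
theorem xac_charIdeal_map_le_span_three_of_dvd
    (hAN : thm351_anacong_branch_three)
    (hDVD : thm336_dvd_branch_OPEN)
    (ι' : PadicAlgCl 3 ≃+* ℂ) (W : WeierstrassCurve ℚ) [W.IsElliptic] [W.IsGloballyMinimal]
    (K : Type) [Field K] [NumberField K] [IsGalois ℚ K]
    (v vbar : HeightOneSpectrum (𝓞 K)) (κ : ZpExtension K 3) (γ : absoluteGaloisGroup K)
    [hγ : Fact (κ.IsTopGenerator γ)] {N : ℕ} [NeZero N] {f : CuspForm (CongruenceSubgroup.Gamma0 N) 2}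
    (hf : IsNewformOf W f) (hS : PotOrdSetting ι' W K v vbar κ N)
    (hX : ClassX3 W 3)
    (hna : ∀ (V : WeierstrassCurve ℚ) [V.IsElliptic] [V.IsGloballyMinimal] (C : VariableChange ℚ),
      GoodOrd V 3 → C • V.quadraticTwist ((-1 : ℚ) ^ (3 / 2) * (3 : ℕ)) = W → ¬ (3 : ℤ) ∣ V.frobeniusTrace 3 - 1)
    (hv3 : ((3 : ℕ) : 𝓞 K) ∈ v.asIdeal)
    {N' : ℕ} [NeZero N'] {f' : CuspForm (CongruenceSubgroup.Gamma0 N') 2} (hf' : IsNewform0 f') (hN' : ¬ 3 ∣ N')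
    (htw : ∃ S : Finset ℕ, ∀ ℓ : ℕ, ℓ.Prime → ℓ ∉ S →
      cuspCoeff f ℓ = ((legendreSym 3 ℓ : ℤ) : ℂ) * cuspCoeff f' ℓ)
    {θsub θquot : FramedGaloisRep K (padicCoeffIntegers (∅ : Set (PadicAlgCl 3))) 1}
    (hpair : IsResidualPairOver (W.baseChange K) 3 θsub θquot)
    {θ₀ : FramedGaloisRep K (padicCoeffIntegers (∅ : Set (PadicAlgCl 3))) 1} (hθ₀ : θ₀ = θsub ∨ θ₀ = θquot)
    {θ₀K : HeckeCharacter K} (hθ₀K : IsHeckeCharOf ι' θ₀ θ₀K) (hv0 : θ₀K.IsUnramifiedAt v) (hvbar0 : θ₀K.IsUnramifiedAt vbar)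
    {Cbar : Finset (HeightOneSpectrum (𝓞 K))} (hCbar : ∀ u ∈ Cbar, ¬ θ₀K.IsUnramifiedAt u)
    {ΩK' : ℂ} {Ωp' : (unrIntegers 3)ˣ} {Lφ : UnrSeries 3} (hΩK' : ΩK' ≠ 0)
    (hLφ : IsKatzLFunction ι' v vbar Cbar κ γ θ₀K ΩK' ((Ωp' : unrIntegers 3) : ℂ_[3]) Lφ)
    {nφ : ℕ} (hnφ : FirstUnitCoeffAt Lφ nφ)
    (hRH : ∀ θ : FramedGaloisRep K (padicCoeffIntegers (∅ : Set (PadicAlgCl 3))) 1, (θ = θsub ∨ θ = θquot) →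
      (∀ D : DatumDualData κ γ (charModule (∅ : Set (PadicAlgCl 3)) θ)
          (Castella2018.AcSelmer.bdpData (charModule (∅ : Set (PadicAlgCl 3)) θ) 3 vbar) (∅ : Set (HeightOneSpectrum (𝓞 K))),
        Module.Finite (IwasawaAlgebra 3) D.X ∧ Module.IsTorsion (IwasawaAlgebra 3) D.X ∧ muInvariant 3 D.X = 0 ∧ lambdaInvariant 3 D.X = nφ) ∧
      ∃ τ ∈ decomp vbar, unitChar θ τ ≠ 1)
    {e : ℂ} {ΩK : ℂ} {Ωp : (unrIntegers 3)ˣ} {L : UnrSeries 3} (he : e = 1 ∨ e = -1) (hΩK : ΩK ≠ 0)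
    (hL : IsBranchBDPLFunction ι' v κ γ f' (KellerYin2024.genusHeckeCharacter K 3) e ΩK ((Ωp : unrIntegers 3) : ℂ_[3]) L)
    (j : ℤ_[3] →+* unrIntegers 3)
    (hj : ∀ x : ℤ_[3], ((j x : unrIntegers 3) : ℂ_[3]) = algebraMap ℚ_[3] ℂ_[3] (x : ℚ_[3])) :
    (XAc.charIdeal (W.baseChange K) 3 κ vbar (∅ : Set (HeightOneSpectrum (𝓞 K))) γ).map (PowerSeries.map j) ≤
      Ideal.span {L} :=
  (xac_charIdeal_map_eq_span_three_of_dvd hAN hDVD ι' W K v vbar κ γ hf hS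
    hX hna hv3 hf' hN' htw hpair hθ₀ hθ₀K hv0 hvbar0 hCbar hΩK' hLφ hnφ hRH he hΩK hL j hj).1.le

end Three

/-! ### §2 H3♭ᶜ at a ♭-frame of the conjugate prime, with the λ-clauses displayed (twin of F39b §1) -/

section Flat

open Summit.BirchSwinnertonDyer.Rank1Residual.X11b.AcSelmer Literature.NumberTheory.EllipticCurves.GreenbergVatsal2000

/-- **H3♭ᶜ at a ♭-frame of the conjugate prime at `p = 3` ⇐ [DIV.dvd] ∧ [AN3] ∧ Castella–Hsieh signed ∧ the comparison data WITH its unramified Rubin–Hida clauses and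
orientation facts — CGLS-§1.2-FREE** — F48b's `xac_charIdeal_map_le_span_three_self_of_dvd` (the Keller–Yin-normalised presented curve with non-anomalous twists, a
residual pair, a member `θ₀` unramified above `3` with its Katz frame) with step 3 on this file's `xac_charIdeal_map_eq_span_three_of_dvd` (NAT index road).
[claim: KellerYin2024PotOrd, status: under-review] [cite: KellerYin2024b, Thm. 3.5.1, Rem. 3.5.2 (arXiv:2410.23241 p. 20) (preprint; the Kolyvagin clause a hypothesis)]
[cite: CastellaHsieh2018, §3.3, Def. 3.7 and Prop. 3.8] [cite: CastellaGrossiLeeSkinner2022, Thms. 1.2.2, 2.1.2, 2.2.2] [cite: KellerYin2024, Thm. 1.4.1 (iii)] -/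
theorem xac_charIdeal_map_le_span_three_self_of_dvd
    (hCHσ : castellaHsieh2018_exists_isBranchBDPLFunction_signed)
    (hDVD : thm336_dvd_branch_OPEN) (hAN : thm351_anacong_branch_three)
    (hmodN : exists_isNewformOf)
    -- the good partner `W′`, the presentation of the door's curve at `p = 3`
    (W' : WeierstrassCurve ℚ) [W'.IsElliptic] (hgood : W'.HasGoodReductionAtPrime 3) (D C₂ : VariableChange ℚ)
    [(C₂ • (D • W').quadraticTwist ((-1 : ℚ) ^ (3 / 2) * (3 : ℕ))).IsElliptic]
    [(C₂ • (D • W').quadraticTwist ((-1 : ℚ) ^ (3 / 2) * (3 : ℕ))).IsGloballyMinimal] {N : ℕ} [NeZero N]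
    (Dt : ModularParametrizationData (C₂ • (D • W').quadraticTwist ((-1 : ℚ) ^ (3 / 2) * (3 : ℕ))) N)
    {N' : ℕ} [NeZero N'] (Dt' : ModularParametrizationData W' N') (hpN' : ¬ 3 ∣ N')
    -- the socket's field, tower, primes, embedding datum; Heegner for `N` and for the partner's level
    {K : Type} [Field K] [NumberField K] [IsGalois ℚ K] (hK : IsImaginaryQuadratic K)
    (hHe : SatisfiesHeegnerHypothesis N K) (hHe' : SatisfiesHeegnerHypothesis N' K)
    (hodd : Odd (NumberField.discr K)) (hdK : NumberField.discr K ≠ -3)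
    {κ : ZpExtension K 3} (hκ : κ.IsAnticyclotomic) (γ : absoluteGaloisGroup K) [hγ : Fact (κ.IsTopGenerator γ)]
    {𝔭 : HeightOneSpectrum (𝓞 K)} (h𝔭 : ((3 : ℕ) : 𝓞 K) ∈ 𝔭.asIdeal)
    (he : 𝔭.asIdeal.ramificationIdx (𝓞 ℚ) = 1) (hf : 𝔭.asIdeal.inertiaDeg (𝓞 ℚ) = 1)
    {𝔭' : HeightOneSpectrum (𝓞 K)} (h𝔭' : ((3 : ℕ) : 𝓞 K) ∈ 𝔭'.asIdeal) (hne : 𝔭 ≠ 𝔭')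
    {ι' : PadicAlgCl 3 ≃+* ℂ} (hι' : BranchInducesPrime 3 ι' 𝔭')
    -- the curve ITSELF carries Keller–Yin's per-curve hypotheses, lies in the (G-ord) cell, and has non-anomalous twists
    (hN : (C₂ • (D • W').quadraticTwist ((-1 : ℚ) ^ (3 / 2) * (3 : ℕ))).conductorNorm ℤ = N)
    (hcase : (C₂ • (D • W').quadraticTwist ((-1 : ℚ) ^ (3 / 2) * (3 : ℕ))).HasGoodOrdinaryReductionOverQuadraticAt 3)
    (hX : ClassX3 (C₂ • (D • W').quadraticTwist ((-1 : ℚ) ^ (3 / 2) * (3 : ℕ))) 3)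
    (hna : ∀ (V : WeierstrassCurve ℚ) [V.IsElliptic] [V.IsGloballyMinimal] (C : VariableChange ℚ),
      GoodOrd V 3 → C • V.quadraticTwist ((-1 : ℚ) ^ (3 / 2) * (3 : ℕ)) =
        C₂ • (D • W').quadraticTwist ((-1 : ℚ) ^ (3 / 2) * (3 : ℕ)) → ¬ (3 : ℤ) ∣ V.frobeniusTrace 3 - 1)
    (hlat : ∃ Φ : AddSubgroup (geomTorsion (C₂ • (D • W').quadraticTwist ((-1 : ℚ) ^ (3 / 2) * (3 : ℕ))) (3 : ℤ)),
      IsRationalLine (C₂ • (D • W').quadraticTwist ((-1 : ℚ) ^ (3 / 2) * (3 : ℕ))) 3 Φ ∧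
        ¬ LineDecompositionTrivialAt (C₂ • (D • W').quadraticTwist ((-1 : ℚ) ^ (3 / 2) * (3 : ℕ))) 3 Φ)
    (htf : ∀ Q : ((C₂ • (D • W').quadraticTwist ((-1 : ℚ) ^ (3 / 2) * (3 : ℕ))).baseChange K).toAffine.Point, 3 • Q = 0 → Q = 0)
    -- the analytic comparison data at `(𝔭′, 𝔭, ι′)`
    {θsub θquot : FramedGaloisRep K (padicCoeffIntegers (∅ : Set (PadicAlgCl 3))) 1}
    (hpair : IsResidualPairOver ((C₂ • (D • W').quadraticTwist ((-1 : ℚ) ^ (3 / 2) * (3 : ℕ))).baseChange K) 3 θsub θquot)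
    {θ₀ : FramedGaloisRep K (padicCoeffIntegers (∅ : Set (PadicAlgCl 3))) 1} (hθ₀ : θ₀ = θsub ∨ θ₀ = θquot)
    {θ₀K : HeckeCharacter K} (hθ₀K : IsHeckeCharOf ι' θ₀ θ₀K) (hv0 : θ₀K.IsUnramifiedAt 𝔭') (hvbar0 : θ₀K.IsUnramifiedAt 𝔭)
    {Cbar : Finset (HeightOneSpectrum (𝓞 K))} (hCbar : ∀ u ∈ Cbar, ¬ θ₀K.IsUnramifiedAt u)
    {ΩK₀ : ℂ} {Ωp₀ : (unrIntegers 3)ˣ} {Lφ : UnrSeries 3} (hΩK₀ : ΩK₀ ≠ 0)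
    (hLφ : IsKatzLFunction ι' 𝔭' 𝔭 Cbar κ γ θ₀K ΩK₀ ((Ωp₀ : unrIntegers 3) : ℂ_[3]) Lφ)
    {nφ : ℕ} (hnφ : FirstUnitCoeffAt Lφ nφ)
    (hRH : ∀ θ : FramedGaloisRep K (padicCoeffIntegers (∅ : Set (PadicAlgCl 3))) 1, (θ = θsub ∨ θ = θquot) →
      (∀ D : DatumDualData κ γ (charModule (∅ : Set (PadicAlgCl 3)) θ)
          (Castella2018.AcSelmer.bdpData (charModule (∅ : Set (PadicAlgCl 3)) θ) 3 𝔭) (∅ : Set (HeightOneSpectrum (𝓞 K))),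
        Module.Finite (IwasawaAlgebra 3) D.X ∧ Module.IsTorsion (IwasawaAlgebra 3) D.X ∧ muInvariant 3 D.X = 0 ∧ lambdaInvariant 3 D.X = nφ) ∧
      ∃ τ ∈ decomp 𝔭, unitChar θ τ ≠ 1)
    -- the ♭-frame at the conjugate prime
    {ΩK' : ℂ} {Ωp' : ℂ_[3]} {Q : PowerSeries (PadicComplexInt 3)} (hΩK' : ΩK' ≠ 0) (hΩp' : Ωp' ≠ 0)
    (hQ : R1.IsBDPLFunctionInt 3 ι' 𝔭' κ γ Dt.f ΩK' Ωp' Q) :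
    (XAc.charIdeal ((C₂ • (D • W').quadraticTwist ((-1 : ℚ) ^ (3 / 2) * (3 : ℕ))).baseChange K) 3 κ 𝔭 ∅ γ).map
        (PowerSeries.map (R1.toCpInt 3)) ≤ Ideal.span {Q} := by
  have hp2 : (3 : ℕ) ≠ 2 := by norm_num
  have hsplit : ((Ideal.span {((3 : ℕ) : ℤ)}).primesOver (𝓞 K)).ncard = 2 :=
    ncard_primesOver_eq_two_of_degreeOne hK.1 h𝔭 he hf
  have hcond : ∀ 𝔮 : HeightOneSpectrum (𝓞 K), ((3 : ℕ) : 𝓞 K) ∈ 𝔮.asIdeal →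
      (KellerYin2024.genusHeckeCharacter K 3).HasConductorExponentAt 𝔮 1 := fun 𝔮 h𝔮 ↦
    KellerYin2024.genusHeckeCharacter_hasConductorExponentAt_one_of_split K 3 hp2 hK hsplit h𝔮
  obtain ⟨e, ΩK, Ωp, L, hesign, hΩK, hL⟩ := hCHσ ι' W' K 𝔭' κ γ Dt'.isNewformOf (KellerYin2024.genusHeckeCharacter K 3) hp2
    hpN' hK hodd hdK hsplit h𝔭' hι' hHe' hκ hγ.out (KellerYin2024.genusHeckeCharacter_sq K 3)
    (fun w hw ↦ KellerYin2024.genusHeckeCharacter_isUnramifiedAt K 3 hw) hcond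
  have hΩp : ((Ωp : unrIntegers 3) : ℂ_[3]) ≠ 0 := by
    rw [Ne, ZeroMemClass.coe_eq_zero]
    exact Ωp.ne_zero
  have hS : PotOrdSetting ι' (C₂ • (D • W').quadraticTwist ((-1 : ℚ) ^ (3 / 2) * (3 : ℕ))) K 𝔭' 𝔭 κ N :=
    potOrdSetting_of_socketData hp2 ι' _ K 𝔭 𝔭' κ N hN hcase hX.1 hlat htf hK hHe hodd hdK hκ h𝔭 he hf hne hι'
  have htw : ∃ S : Finset ℕ, ∀ ℓ : ℕ, ℓ.Prime → ℓ ∉ S →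
      cuspCoeff Dt.f ℓ = ((legendreSym 3 ℓ : ℤ) : ℂ) * cuspCoeff Dt'.f ℓ :=
    exists_cofinite_cuspCoeff_eq_legendreSym_mul hp2 W' D C₂ Dt Dt'
  have heq := (xac_charIdeal_map_eq_span_three_of_dvd hAN hDVD ι'
    _ K 𝔭' 𝔭 κ γ Dt.isNewformOf hS hX hna h𝔭' Dt'.isNewformOf.1 hpN' htw hpair hθ₀ hθ₀K hv0 hvbar0 hCbar hΩK₀ hLφ hnφ hRH
    hesign hΩK hL (toUnr 3) (coe_toUnr 3)).1
  have hdiv : (XAc.charIdeal ((C₂ • (D • W').quadraticTwist ((-1 : ℚ) ^ (3 / 2) * (3 : ℕ))).baseChange K) 3 κ 𝔭 ∅ γ).map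
      (PowerSeries.map (toUnr 3)) ≤ Ideal.span {L} := by
    rw [xac_charIdeal_eq_literature, heq]
  have hKp : Algebra.IsUnramifiedIn (𝓞 K) (Ideal.span {((3 : ℕ) : ℤ)}) := isUnramifiedIn_of_splitsTwo hK hsplit
  obtain ⟨c, hc, -⟩ := exists_coe_eq_symm_of_sign (p := 3) (ι := ι') hesign
  have hLQ : Ideal.span {PowerSeries.map (R1.unrToCpInt 3) L} ≤ Ideal.span {Q} :=
    span_map_le_span_of_isBranchBDPLFunction_of_isBDPLFunctionInt hp2 hK hKp Dt.f Dt'.f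
      (fun _ hℓ hℓp ↦ cuspCoeff_eq_legendreSym_mul_of_presentation hp2 W' D C₂ Dt.isNewformOf Dt'.isNewformOf hℓ hℓp)
      (cuspCoeff_prime_eq_zero_of_presentation hp2 W' hgood D C₂ Dt)
      (prime_dvd_level_of_presentation hmodN hp2 W' hgood D C₂ Dt)
      (fun _ hℓ hℓp ↦ dvd_level_iff_dvd_level_partner_of_presentation hmodN hp2 W' hgood D C₂ Dt Dt' hℓ hℓp)
      hκ hγ.out hΩK hΩK' hΩp hΩp' hL hQ hc
  exact (map_toCpInt_le_span_of_map_toUnr_le_span hdiv).trans hLQ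

end Flat

end Summit.BirchSwinnertonDyer.BirchSwinnertonDyer.Theorems.SchneiderFreeAdditiveX3.NATKYBranchThreeDoor

end
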